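import Mathlib
import HarnessLib
import Literature.NumberTheory.GaloisRepresentations.GaloisRep

/-!
# Stub `stub_not_twistEquivalent_of_certificate` (line `birth`, crux `ExplicitRamifiedFamily`, stmt-Langlands-16778)

One violating element certifies twist-inequivalence of two rank-`3` representations.

For continuous `ρ, ρ' : Γ_K → GL₃(ℚ̄_p)`: if some `σ` has `tr ρ(σ)³ · det ρ'(σ) ≠ tr ρ'(σ)³ · det ρ(σ)`,
then there is no character `χ : Γ_K → GL₁(ℚ̄_p)` with `tr ρ(g) = χ(g)₀₀ · tr ρ'(g)` for all `g`.

Proof (folklore, the Frobenius test of van Geemen–Top). Suppose such a `χ` exists and specialise the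
identity at `g = σ, σ², σ³`. Since `ρ, ρ', χ` are monoid homomorphisms, with `M = ρ(σ)`, `M' = ρ'(σ)`,
`s = χ(σ)₀₀` the first three power sums satisfy `tr Mᵏ = sᵏ · tr M'ᵏ` (`k = 1, 2, 3`). Newton's
identity for `3 × 3` matrices over any commutative ring, `6 det N = (tr N)³ − 3 tr N · tr N² + 2 tr N³`
(a brute-force `ring` identity after `Matrix.det_fin_three` / `Matrix.trace_fin_three`), applied to `M`
and `M'` gives `6 det M = s³ · 6 det M'`, so `det M = s³ det M'` in characteristic `0`; together with
`tr M = s · tr M'` this yields `(tr M)³ det M' = (tr M')³ det M`, contradicting the certificate.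
Nothing about Galois groups is used beyond "`ρ, ρ', χ` are group homomorphisms".
-/

set_option linter.dupNamespace false -- `Summit.Langlands.Langlands` is the mandated namespace

namespace Summit.Langlands.Langlands.Cruxes.ExplicitRamifiedFamily.Birth

/-- **Newton's identity for `3 × 3` matrices** over a commutative ring:
`6 · det N = (tr N)³ − 3 · tr N · tr (N²) + 2 · tr (N³)`. Brute force on the nine entries. -/
private theorem six_mul_det_fin_three {R : Type*} [CommRing R] (N : Matrix (Fin 3) (Fin 3) R) :
    6 * N.det = N.trace ^ 3 - 3 * N.trace * (N ^ 2).trace + 2 * (N ^ 3).trace := by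
  rw [pow_three' N, sq N]
  simp only [Matrix.det_fin_three, Matrix.trace_fin_three, Matrix.mul_apply, Fin.sum_univ_three]
  ring

/-- For a `1 × 1` matrix `A`, the `(0,0)` entry of `A ^ k` is `(A 0 0) ^ k`. -/
private theorem pow_apply_zero_zero_fin_one {R : Type*} [CommRing R] (A : Matrix (Fin 1) (Fin 1) R)
    (k : ℕ) : (A ^ k) 0 0 = A 0 0 ^ k := by
  rw [← Matrix.det_fin_one (A ^ k), Matrix.det_pow, Matrix.det_fin_one]

/-- **The algebraic core.** Over a field of characteristic `0`: if the first three power sums of the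
`3 × 3` matrices `M`, `M'` satisfy `tr Mᵏ = sᵏ · tr M'ᵏ` (`k = 1, 2, 3`) for some scalar `s`, then
`(tr M)³ · det M' = (tr M')³ · det M` (via Newton: `det M = s³ · det M'`). -/
private theorem trace_cube_mul_det_eq_of_powerSums {F : Type*} [Field F] [CharZero F]
    (M M' : Matrix (Fin 3) (Fin 3) F) (s : F) (h1 : M.trace = s * M'.trace)
    (h2 : (M ^ 2).trace = s ^ 2 * (M' ^ 2).trace) (h3 : (M ^ 3).trace = s ^ 3 * (M' ^ 3).trace) :
    M.trace ^ 3 * M'.det = M'.trace ^ 3 * M.det := by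
  have hM := six_mul_det_fin_three M
  have hM' := six_mul_det_fin_three M'
  have hdet : M.det = s ^ 3 * M'.det := by
    have h6 : (6 : F) ≠ 0 := by norm_num
    refine mul_left_cancel₀ h6 ?_
    rw [h1, h2, h3] at hM
    linear_combination hM - s ^ 3 * hM'
  rw [hdet, h1]
  ring

/-- **STUB 2 — one violating element certifies twist-inequivalence.** For continuous
`ρ, ρ' : Γ_K → GL₃(ℚ̄_p)`: if some `σ` has `tr ρ(σ)³ · det ρ'(σ) ≠ tr ρ'(σ)³ · det ρ(σ)`, then there is
NO character `χ : Γ_K → GL₁(ℚ̄_p)` with `tr ρ(g) = χ(g)₀₀ · tr ρ'(g)` for all `g`. Proof: specialise the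
identity at `σ, σ², σ³` (`ρ(σᵏ) = ρ(σ)ᵏ`, `χ(σᵏ)₀₀ = (χ(σ)₀₀)ᵏ`), so the first three power sums of
`M = ρ(σ)` are `sᵏ` times those of `M' = ρ'(σ)`; Newton's identity for `3 × 3` matrices and
`CharZero ℚ̄_p` give `det M = s³ det M'`, hence `(tr M)³ det M' = (tr M')³ det M` — contradiction.
[folklore] -/
theorem stub_not_twistEquivalent_of_certificate :
    ∀ (p : ℕ) [Fact p.Prime] (K : Type) [Field K]
      (ρ ρ' : Literature.NumberTheory.GaloisRepresentations.FramedGaloisRep K (PadicAlgCl p) 3),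
      (∃ σ : Field.absoluteGaloisGroup K,
          (ρ σ).val.trace ^ 3 * (ρ' σ).val.det ≠ (ρ' σ).val.trace ^ 3 * (ρ σ).val.det) →
      ¬ ∃ χ : Literature.NumberTheory.GaloisRepresentations.FramedGaloisRep K (PadicAlgCl p) 1,
          ∀ σ, (ρ σ).val.trace = (χ σ).val 0 0 * (ρ' σ).val.trace := by
  intro p _ K _ ρ ρ' ⟨σ, hσ⟩ ⟨χ, hχ⟩
  apply hσ
  have hk : ∀ k : ℕ,
      ((ρ σ).val ^ k).trace = ((χ σ).val 0 0) ^ k * ((ρ' σ).val ^ k).trace := by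
    intro k
    have h := hχ (σ ^ k)
    rw [map_pow, map_pow, map_pow, Units.val_pow_eq_pow_val, Units.val_pow_eq_pow_val,
      Units.val_pow_eq_pow_val, pow_apply_zero_zero_fin_one] at h
    exact h
  have h1 := hk 1
  simp only [pow_one] at h1
  exact trace_cube_mul_det_eq_of_powerSums _ _ _ h1 (hk 2) (hk 3)

end Summit.Langlands.Langlands.Cruxes.ExplicitRamifiedFamily.Birth
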